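import Summits.BirchSwinnertonDyer.BirchSwinnertonDyer.Theorems.AlignedTransportAtTwoMainConjectureOfRankZeroBSDAtTwoResolventLambdaParitySeeds
import Literature.NumberTheory.IwasawaTheory.FerreroKidaLambdaTwoImaginaryQuadraticProof
import HarnessLib

/-!
# Route `AlignedTransportAtTwo`, crux C2 `MainConjectureOfRankZeroBSDAtTwo` (stmt-BirchSwinnertonDyer-22298):
# the Ferrero–Kida hypothesis `hFK` DISCHARGED — the resolvent parity law and the census bounds are now unconditional

HONEST FRAMING (cell `bsd-f1-sign2`, WIDTH-5 attached prover seat `bsd-line-att-p3` gen 32; `--supports` stmt-BirchSwinnertonDyer-22298, closes nothing; BSD is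
NOT proved; the crux C2 and its verdict «blocked-on `Rank1Residual.GreenbergMuConjectureIrreducible`» are untouched).  The named fact
`IwasawaTheory.ferreroKida_classicalLambda_two_imaginaryQuadratic` (Ferrero 1980 / Kida 1979: `λ₂(ℚ(√−d)) + 1 = Σ_{p ∣ d, p ≠ 2} 2^{ord₂(p²−1)−3}`, `μ₂ = 0`) is now a
THEOREM of the tree (`ferreroKida_classicalLambda_two_imaginaryQuadratic_holds`, this seat: genus theory and the capitulation kernel `{1, [𝔓_n]}` of the `2`-ramified
towers for the lower bound, Fukuda's growth step with the invariant non-square dyadic class for the upper bound, the reduction `d ↦ d/2` for even `d`, and prover g31's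
`d ≡ 3 (mod 4)` half).  This file records the UNCONDITIONAL forms of g29's conditional results (`…ResolventLambdaParity`, `…ResolventLambdaParitySeeds`), obtained by
applying them to the proved fact:

* `odd_classicalLambda_iff` — `K ∋ √−d` quadratic, `d > 2` odd squarefree (both residues mod `4`): `μ₂(K) = 0` and `λ₂(K)` is odd iff `d ≡ ±1 (mod 8)`;
* `ferreroKidaSum_le_classicalLambda_divisionField_two_succ` — `λ₂(ℚ(W[2])) + 1 ≥ Σ_{p ∣ d} 2^{ord₂(p²−1)−3}` for EVERY squarefree `d > 2` (granted `μ = 0`), and its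
  certificate form `ferreroKidaSum_le_classGroupPRank_succ_of_rankCert`;
* the census numbers: `λ₂ ≥ 17` for 7831a1, `λ₂ ≥ 33` for 24213c1, `λ₂ ≥ 3` for 25861b1 (granted `μ = 0`), and the certificate thresholds `17`, `33`.
(The Kilford-sub-cell statements — `d ≡ 7 (mod 8)`, hence `d ≡ 3 (mod 4)` — were already unconditional by g31's half: tree `…ResolventLambdaExact`.)

References: [Schettler2014] Thm. 2; [Ferrero1980AJM]; [Kida1979Tohoku]; [Washington1997] §13.3; [Fukuda1994] Thm. 1.
-/

set_option linter.dupNamespace false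
set_option autoImplicit false

noncomputable section

open scoped Classical NumberField

namespace Summit.BirchSwinnertonDyer.BirchSwinnertonDyer.Theorems.AlignedTransportAtTwoResolventLambdaUnconditional

open Polynomial WeierstrassCurve IntermediateField Field NumberField Finset
  Literature.NumberTheory.EllipticCurves Literature.NumberTheory.EllipticCurves.Greenberg1999 Literature.NumberTheory.GaloisRepresentations
  Literature.NumberTheory.IwasawaTheory Literature.NumberTheory.NumberFields
  Summit.BirchSwinnertonDyer.Rank1Residual.F1Sign2
  Summit.BirchSwinnertonDyer.BirchSwinnertonDyer.Theorems.AlignedTransportAtTwoKilfordStratumShared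
  Summit.BirchSwinnertonDyer.BirchSwinnertonDyer.Theorems.AlignedTransportAtTwoResolventLambdaParity
  Summit.BirchSwinnertonDyer.BirchSwinnertonDyer.Theorems.AlignedTransportAtTwoResolventLambdaParitySeeds
  Summit.BirchSwinnertonDyer.BirchSwinnertonDyer.Theorems.TowerClass

/-! ## §1 The quadratic field and the resolvent -/

/-- ★ **`λ₂(K)` is ODD iff `d ≡ ±1 (mod 8)`** (and `μ₂(K) = 0`) for `K` quadratic containing `δ` with `δ² = −d`, `d > 2` odd squarefree, `κ` any cyclotomic `ℤ₂`-extension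
of `K` — UNCONDITIONAL (Ferrero–Kida is a theorem of the tree). [cite: Schettler2014, Thm. 2] -/
theorem odd_classicalLambda_iff {K : Type} [Field K] [NumberField K] {d : ℕ} (hd : Squarefree d) (hodd : Odd d) (h2 : 2 < d)
    (hK : Module.finrank ℚ K = 2) (hδ : ∃ δ : K, δ ^ 2 = -((d : ℕ) : K)) (κ : ZpExtension K 2) (hκ : κ.IsCyclotomic) :
    ClassicalMuVanishes κ ∧ (Odd (classicalLambda κ) ↔ (d % 8 = 1 ∨ d % 8 = 7)) :=
  odd_classicalLambda_iff_of_ferreroKida ferreroKida_classicalLambda_two_imaginaryQuadratic_holds hd hodd h2 hK hδ κ hκ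

variable (W : WeierstrassCurve ℚ) [W.IsElliptic]

/-- ★ **`λ₂(ℚ(W[2])^{cyc}) + 1 ≥ Σ_{p ∣ d, p odd} 2^{ord₂(p²−1)−3}`** for `Δ_W = −d·q²` (`d > 2` squarefree), `κT` any cyclotomic `ℤ₂`-extension of `ℚ(W[2])` with `μ = 0` —
UNCONDITIONAL in Ferrero–Kida. [cite: Schettler2014, Thm. 2] [cite: Washington1997, §13.3 Thm. 13.13] -/
theorem ferreroKidaSum_le_classicalLambda_divisionField_two_succ {d : ℕ} (hd : Squarefree d) (h2 : 2 < d) {q : ℚ} (hq : q ≠ 0)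
    (hΔ : W.Δ = -(d : ℚ) * q ^ 2) {δ : AlgebraicClosure ℚ} (hδ : δ ^ 2 = ((W.Δ : ℚ) : AlgebraicClosure ℚ))
    (κT : ZpExtension (W.divisionField 2) 2) (hκT : κT.IsCyclotomic) (hμ : ClassicalMuVanishes κT) :
    ∑ p ∈ d.primeFactors.erase 2, 2 ^ (padicValNat 2 (p ^ 2 - 1) - 3) ≤ classicalLambda κT + 1 :=
  AlignedTransportAtTwoResolventLambdaParity.ferreroKidaSum_le_classicalLambda_divisionField_two_succ W
    ferreroKida_classicalLambda_two_imaginaryQuadratic_holds hd h2 hq hΔ hδ κT hκT hμ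

/-- **With a rank certificate: `Σ_{p ∣ d} 2^{ord₂(p²−1)−3} ≤ rank₂ Cl(T_n) + 1`** on the Kilford sub-cell — UNCONDITIONAL in Ferrero–Kida.
[cite: Fukuda1994, Thm. 1 (2), p. 264] [cite: Schettler2014, Thm. 2] -/
theorem ferreroKidaSum_le_classGroupPRank_succ_of_rankCert (ht : ∀ x : ℚ, ¬ HasRationalTwoTorsionX W x) (hs : OnKilfordStratumAtTwo W)
    {d : ℕ} (hd : Squarefree d) (h2 : 2 < d) {q : ℚ} (hq : q ≠ 0) (hΔ : W.Δ = -(d : ℚ) * q ^ 2)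
    {δ : AlgebraicClosure ℚ} (hδ : δ ^ 2 = ((W.Δ : ℚ) : AlgebraicClosure ℚ))
    (κT : ZpExtension (W.divisionField 2) 2) (hκT : κT.IsCyclotomic)
    {n : ℕ} (hcert : classGroupPRank κT (n + 1) = classGroupPRank κT n) :
    ∑ p ∈ d.primeFactors.erase 2, 2 ^ (padicValNat 2 (p ^ 2 - 1) - 3) ≤ classGroupPRank κT n + 1 :=
  AlignedTransportAtTwoResolventLambdaParity.ferreroKidaSum_le_classGroupPRank_succ_of_rankCert W
    ferreroKida_classicalLambda_two_imaginaryQuadratic_holds ht hs hd h2 hq hΔ hδ κT hκT hcert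

/-! ## §2 The census numbers, unconditional -/

/-- ★ **7831a1: `λ₂(ℚ(W[2])^{cyc}) ≥ 17`** for every cyclotomic `ℤ₂`-extension of `ℚ(7831a1[2])` with `μ = 0` — UNCONDITIONAL (`λ₂(ℚ(√−7831)) = 17` is proved).
[cite: Schettler2014, Thm. 2] [cite: CremonaAlgorithms1997, Table 1] -/
theorem seventeen_le_classicalLambda_7831a1 (κT : ZpExtension (c7831a1.divisionField 2) 2) (hκT : κT.IsCyclotomic) (hμ : ClassicalMuVanishes κT) :
    17 ≤ classicalLambda κT :=
  AlignedTransportAtTwoResolventLambdaParitySeeds.seventeen_le_classicalLambda_7831a1 ferreroKida_classicalLambda_two_imaginaryQuadratic_holds κT hκT hμ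

/-- ★ **7831a1: every 2-rank certificate on the sextic tower has value `≥ 17`** — UNCONDITIONAL. [cite: Fukuda1994, Thm. 1 (2), p. 264] [cite: Schettler2014, Thm. 2] -/
theorem seventeen_le_classGroupPRank_of_rankCert_7831a1 (κT : ZpExtension (c7831a1.divisionField 2) 2) (hκT : κT.IsCyclotomic) {n : ℕ}
    (hcert : classGroupPRank κT (n + 1) = classGroupPRank κT n) : 17 ≤ classGroupPRank κT n :=
  AlignedTransportAtTwoResolventLambdaParitySeeds.seventeen_le_classGroupPRank_of_rankCert_7831a1 ferreroKida_classicalLambda_two_imaginaryQuadratic_holds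
    κT hκT hcert

/-- ★ **24213c1: `λ₂(ℚ(W[2])^{cyc}) ≥ 33`** (granted `μ = 0`) — UNCONDITIONAL (`λ₂(ℚ(√−8071)) = 33` is proved). [cite: Schettler2014, Thm. 2] [cite: CremonaAlgorithms1997, Table 1] -/
theorem thirtythree_le_classicalLambda_24213c1 (κT : ZpExtension (c24213c1.divisionField 2) 2) (hκT : κT.IsCyclotomic) (hμ : ClassicalMuVanishes κT) :
    33 ≤ classicalLambda κT :=
  AlignedTransportAtTwoResolventLambdaParitySeeds.thirtythree_le_classicalLambda_24213c1 ferreroKida_classicalLambda_two_imaginaryQuadratic_holds κT hκT hμ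

/-- ★ **24213c1: every 2-rank certificate on the sextic tower has value `≥ 33`** — UNCONDITIONAL. [cite: Fukuda1994, Thm. 1 (2), p. 264] [cite: Schettler2014, Thm. 2] -/
theorem thirtythree_le_classGroupPRank_of_rankCert_24213c1 (κT : ZpExtension (c24213c1.divisionField 2) 2) (hκT : κT.IsCyclotomic) {n : ℕ}
    (hcert : classGroupPRank κT (n + 1) = classGroupPRank κT n) : 33 ≤ classGroupPRank κT n :=
  AlignedTransportAtTwoResolventLambdaParitySeeds.thirtythree_le_classGroupPRank_of_rankCert_24213c1 ferreroKida_classicalLambda_two_imaginaryQuadratic_holds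
    κT hκT hcert

/-- **25861b1: `λ₂(ℚ(W[2])^{cyc}) ≥ 3`** through the resolvent (`λ₂(ℚ(√−2351)) = 3`, proved; granted `μ = 0`) — UNCONDITIONAL. [cite: Schettler2014, Thm. 2]
[cite: CremonaAlgorithms1997, Table 1] -/
theorem three_le_classicalLambda_25861b1 (κT : ZpExtension (c25861b1.divisionField 2) 2) (hκT : κT.IsCyclotomic) (hμ : ClassicalMuVanishes κT) :
    3 ≤ classicalLambda κT :=
  AlignedTransportAtTwoResolventLambdaParitySeeds.three_le_classicalLambda_25861b1 ferreroKida_classicalLambda_two_imaginaryQuadratic_holds κT hκT hμ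

end Summit.BirchSwinnertonDyer.BirchSwinnertonDyer.Theorems.AlignedTransportAtTwoResolventLambdaUnconditional

end
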